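import Summits.Ventures.PercRepro.Night2OneFatFaces

/-!
# PercRepro — a lossy superset of a basis adds only points on a line through two basis points (night-2, gen 29)

For the basis pairs' fair-share inequality (the second input of `localShadowHall_of_gt2`) the targets of a lossy basis pair
`(B, z)` are the sets `K ∪ X ∪ Y` (`X = (B ∪ {z}) ∖ K` an independent `5`-set, `Y ≠ ∅` off `X`); a SATURATED target (a lossy
big covering set, `cap2 = 0`) has three coloops and a rank-`2` rest `R` (`Night2OneFatFaces`).  Since an independent set
meets a line in at most two points, `R` contains all of `Y` and exactly two points of `X`: **the saturated targets of a basis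
pair lie on the lines through two of its points** — their number is `Σ_{x ≠ x′ ∈ X} (2^{|line(x, x′) ∩ V ∖ X|} − 1)`, the
count the successor needs for the floors of `Night2TwoOneAssemblyW`.

* **`subset_rest_of_indep_basis`**: `Y ⊆ R` and `|R ∩ X| = 2`.
-/

namespace PercRepro.Shadow

open Finset PerFlat ThmH

variable {α : Type*} [DecidableEq α] {M : Matroid α} [M.Finite]

section BasisTargets

/-- **A lossy superset of an independent `5`-set adds only non-coloops, all on the line of the rest**: if `T = X ∪ Y`
(`X` independent with five points, `Y` disjoint from `X`) has exactly three coloops and its rest `R = T ∖ coloops` has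
rank `2`, then `Y ⊆ R` and `R` meets `X` in exactly two points. -/
theorem subset_rest_of_indep_basis {X Y : Finset α} (hXi : M.Indep (X : Set α))
    (hX5 : X.card = 5) (hXY : Disjoint X Y) (hC : (coloops M (X ∪ Y)).card = 3)
    (hR : rkN M ((X ∪ Y) \ coloops M (X ∪ Y)) = 2) :
    Y ⊆ (X ∪ Y) \ coloops M (X ∪ Y) ∧ (((X ∪ Y) \ coloops M (X ∪ Y)) ∩ X).card = 2 := by
  set T := X ∪ Y with hT
  set C := coloops M T with hCdef
  set R := T \ C with hRdef
  have hCT : C ⊆ T := fun w hw => (mem_coloops.1 hw).1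
  have hC3 : C.card = 3 := hC
  have hRcard : R.card + 3 = T.card := by
    have := Finset.card_sdiff_add_card_eq_card hCT
    rw [hC3] at this
    exact this
  have hTcard : T.card = 5 + Y.card := by
    rw [hT, Finset.card_union_of_disjoint hXY, hX5]
  -- `R ∩ X` is independent of rank `≤ 2`, hence has at most two points
  have hRX2 : (R ∩ X).card ≤ 2 := by
    have hind : M.Indep ((R ∩ X : Finset α) : Set α) := hXi.subset (by
      rw [Finset.coe_subset]; exact Finset.inter_subset_right)
    have h1 : rkN M (R ∩ X) = (R ∩ X).card := rkN_eq_card_of_indep hind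
    have h2 : rkN M (R ∩ X) ≤ rkN M R := rkN_mono Finset.inter_subset_left
    omega
  -- `R ∩ Y` has at least `|Y|` points, so `Y ⊆ R`
  have hRsplit : (R ∩ X).card + (R ∩ Y).card = R.card := by
    have h1 : R ∩ X ∪ R ∩ Y = R := by
      rw [← Finset.inter_union_distrib_left, ← hT]
      exact Finset.inter_eq_left.2 Finset.sdiff_subset
    have h2 : Disjoint (R ∩ X) (R ∩ Y) :=
      Finset.disjoint_of_subset_left Finset.inter_subset_right
        (Finset.disjoint_of_subset_right Finset.inter_subset_right hXY)
    rw [← Finset.card_union_of_disjoint h2, h1]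
  have hRY : (R ∩ Y).card = Y.card := by
    have h1 : (R ∩ Y).card ≤ Y.card := Finset.card_le_card Finset.inter_subset_right
    omega
  have hYR : Y ⊆ R := by
    have h := Finset.eq_of_subset_of_card_le (Finset.inter_subset_right : R ∩ Y ⊆ Y) (by omega)
    intro y hy
    rw [← h] at hy
    exact (Finset.mem_inter.1 hy).1
  refine ⟨hYR, ?_⟩
  omega

end BasisTargets

end PercRepro.Shadow
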